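import Mathlib.Algebra.Tropical.Basic
import Mathlib.Algebra.Tropical.BigOperators
import Mathlib.Algebra.Order.AddGroupWithTop
import Mathlib.Data.Matrix.Basic
import Mathlib.Data.Matrix.Mul
import Mathlib.Combinatorics.SimpleGraph.Diam
import HarnessLib

-- provenance: harness21/H21/H21/Prelude/CryptoQuantFine/GraphPathProblems.lean @ 7f20f4c (interim HEAD d8f2665); M5 mechanical rewrite
/-!
# Weighted graph path problems: APSP, (min,+)-product, Negative Triangle, Radius

Trunk `CryptoQuantFine`, prelude file F2 (`GraphPathProblems`). This file sets up the objects of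
the fine-grained "APSP world" of V. Vassilevska Williams and R. Williams,
*Subcubic equivalences between path, matrix, and triangle problems*, J. ACM 65 (2018), §1 and §4:

* weighted directed graphs on a finite vertex type `ι`, given by a weight matrix
  `W : Matrix ι ι (WithTop ℤ)` (`⊤` = no edge);
* the `(min,+)`-product of two such matrices (`minPlusProduct`);
* all-pairs shortest-path distances (`shortestDist`) via the classical characterisation
  "`k`-th `(min,+)`-power of `I ⊕ W` = minimum weight over walks with at most `k` edges"
  (Cormen–Leiserson–Rivest–Stein, *Introduction to Algorithms*, §25.1), realised through
  Mathlib's tropical semiring `Tropical (WithTop ℤ)` and the `Matrix` semiring over it;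
* the Negative Triangle predicate on integer-weighted complete digraphs;
* weighted eccentricity / radius / diameter;
* the bridge `zeroOneWeights` from a `SimpleGraph` to unit weights.

## Mathlib anchors (reused, not redefined)

* `Tropical R`, `Tropical.trop`, `Tropical.untrop` and the `CommSemiring (Tropical R)` instance for
  `R` a `LinearOrderedAddCommMonoidWithTop`; `WithTop ℤ` acquires this structure from the instance
  `LinearOrderedAddCommGroupWithTop (WithTop G)` in `Mathlib.Algebra.Order.AddGroupWithTop`.
  In `Tropical (WithTop ℤ)`, `+` is `min`, `*` is `+`, `0 = trop ⊤`, `1 = trop 0`.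
* `Matrix`, `Matrix.map`, matrix powers in the semiring `Matrix ι ι (Tropical (WithTop ℤ))`.
* `Finset.untrop_sum'` (tropical sums are `Finset.inf`).
* Unweighted notions `SimpleGraph.edist`, `SimpleGraph.eccent`, `SimpleGraph.ediam`,
  `SimpleGraph.diam`, `SimpleGraph.radius` (`Mathlib.Combinatorics.SimpleGraph.Diam`) exist and are
  used for the sparse unweighted statements downstream; here we only relate them to the weighted
  notions via `zeroOneWeights` (`shortestDist_zeroOneWeights`).

## Design choices

* The vertex type is a general `[Fintype ι] [DecidableEq ι]` (downstream instances use `ι = Fin n`).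
  `shortestDist W := walkDistLE W (Fintype.card ι)`; in the absence of negative cycles, walks with at
  most `card ι` edges (indeed `card ι - 1`) already realise all shortest distances
  (`shortestDist_eq_walkDistLE_of_le`). In the presence of a negative cycle `shortestDist` is only the
  `≤ card ι`-edge walk optimum (a documented junk value; the APSP problem downstream assumes
  `HasNoNegativeCycle`).
* `WithTop ℤ` has a top but no bottom element, so infima over vertices are `Finset.inf` while suprema
  (eccentricity, diameter) use `Finset.sup'` and require `[Nonempty ι]`.
* All lemma proofs except the trivial unfolding ones are `sorry` (statement library).
-/

namespace Literature.Computability.Cryptography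

open Matrix Tropical

variable {ι : Type*}

/-! ### Weight matrices and the tropical encoding -/

/-- The tropical encoding of a weight matrix `W : Matrix ι ι (WithTop ℤ)` (`⊤` = no edge):
entrywise `Tropical.trop`, landing in the `(min,+)` semiring `Tropical (WithTop ℤ)`.
Source: Vassilevska Williams–Williams, J. ACM 65 (2018), §4 (the `(min,+)` structure);
Mathlib `Tropical`. [folklore] -/
def tropAdj (W : Matrix ι ι (WithTop ℤ)) : Matrix ι ι (Tropical (WithTop ℤ)) :=
  W.map trop

/-- Entries of `tropAdj W` are `trop (W i j)`. Source: definition unfolding (Mathlib `Matrix.map`). [folklore] -/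
@[simp]
theorem tropAdj_apply (W : Matrix ι ι (WithTop ℤ)) (i j : ι) : tropAdj W i j = trop (W i j) :=
  rfl

/-- `HasBoundedWeights W M`: every finite entry of the weight matrix `W` lies in `[-M, M]`
(the "polynomially bounded integer weights" hypothesis of fine-grained APSP, with `M = n ^ c`).
Source: Vassilevska Williams–Williams, J. ACM 65 (2018), §1 (weights in `{-M, …, M}`). [folklore] -/
def HasBoundedWeights (W : Matrix ι ι (WithTop ℤ)) (M : ℕ) : Prop :=
  ∀ i j, W i j = ⊤ ∨ ∃ z : ℤ, W i j = z ∧ |z| ≤ M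

/-- The Negative Triangle problem: an integer-weighted complete digraph `W` on `ι` has three pairwise
distinct vertices `i, j, k` with `W i j + W j k + W k i < 0`.
Source: Vassilevska Williams–Williams, J. ACM 65 (2018), §1 and Theorem 1.1 (Negative Triangle). [folklore] -/
def HasNegativeTriangle (W : Matrix ι ι ℤ) : Prop :=
  ∃ i j k, i ≠ j ∧ j ≠ k ∧ i ≠ k ∧ W i j + W j k + W k i < 0

/-- Unit weights from a simple graph: `zeroOneWeights G i j = 1` if `G.Adj i j` and `⊤` otherwise
(the diagonal is `⊤`; the empty walk contributes distance `0` in `walkDistLE`). This is the bridge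
from the unweighted (`SimpleGraph.edist`) to the weighted (`shortestDist`) setting.
Source: Vassilevska Williams–Williams, J. ACM 65 (2018), §1 (unweighted graphs as `{1, ∞}`-weighted
ones). [folklore] -/
def zeroOneWeights (G : SimpleGraph ι) [DecidableRel G.Adj] : Matrix ι ι (WithTop ℤ) :=
  Matrix.of fun i j => if G.Adj i j then 1 else ⊤

/-- Entries of `zeroOneWeights G`: `1` on edges, `⊤` elsewhere. Source: definition unfolding. [folklore] -/
@[simp]
theorem zeroOneWeights_apply (G : SimpleGraph ι) [DecidableRel G.Adj] (i j : ι) :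
    zeroOneWeights G i j = if G.Adj i j then 1 else ⊤ :=
  rfl

section Fintype

variable [Fintype ι]

/-- The `(min,+)`-product (distance product) of two weight matrices:
`(A ⋆ B) i j = min_k (A i k + B k j)`, realised as the tropical matrix product.
Source: Vassilevska Williams–Williams, J. ACM 65 (2018), §1 ("distance product"). [folklore] -/
def minPlusProduct (A B : Matrix ι ι (WithTop ℤ)) : Matrix ι ι (WithTop ℤ) :=
  (tropAdj A * tropAdj B).map untrop

/-- Entry formula for the `(min,+)`-product: `minPlusProduct A B i j = min_k (A i k + B k j)`
(the minimum over the finite vertex set, `⊤` if `ι` is empty).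
Source: Vassilevska Williams–Williams, J. ACM 65 (2018), §1. [folklore] -/
theorem minPlusProduct_apply (A B : Matrix ι ι (WithTop ℤ)) (i j : ι) :
    minPlusProduct A B i j = Finset.univ.inf fun k => A i k + B k j := by
  simp only [minPlusProduct, Matrix.map_apply, Matrix.mul_apply, Finset.untrop_sum']
  rfl

variable [DecidableEq ι]

/-- `walkDistLE W k i j` is the minimum weight of a walk from `i` to `j` using at most `k` edges
(`⊤` if there is none), computed as the `(i,j)` entry of the `k`-th tropical power of `1 + tropAdj W`
(`1` is the tropical identity matrix: `trop 0` on the diagonal, `trop ⊤` off it).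
Source: Cormen–Leiserson–Rivest–Stein, *Introduction to Algorithms*, §25.1
(shortest paths and matrix multiplication). [folklore] -/
def walkDistLE (W : Matrix ι ι (WithTop ℤ)) (k : ℕ) : Matrix ι ι (WithTop ℤ) :=
  ((1 + tropAdj W) ^ k).map untrop

/-- All-pairs shortest-path distances of the weighted digraph `W`: `shortestDist W i j` is the minimum
weight of a walk from `i` to `j` with at most `Fintype.card ι` edges. When `W` has no negative cycle
this is the shortest-path distance (CLRS §25.1, Lemma 24.10/25.1: shortest paths have `≤ |V| - 1`
edges); otherwise it is a documented junk value.
Source: Vassilevska Williams–Williams, J. ACM 65 (2018), §1 (APSP); CLRS §25.1. [folklore] -/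
def shortestDist (W : Matrix ι ι (WithTop ℤ)) : Matrix ι ι (WithTop ℤ) :=
  walkDistLE W (Fintype.card ι)

/-- `W` has no negative cycle: every closed walk (with at most `card ι` edges, which suffices) has
nonnegative weight, i.e. the diagonal of `shortestDist W` is `0` (the empty walk).
Source: CLRS §25 (negative-weight cycles); Vassilevska Williams–Williams, J. ACM 65 (2018), §4
(APSP instances are assumed free of negative cycles). [folklore] -/
def HasNoNegativeCycle (W : Matrix ι ι (WithTop ℤ)) : Prop :=
  ∀ i, shortestDist W i i = 0

/-! ### Eccentricity, radius, diameter (weighted) -/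

/-- The weighted eccentricity of vertex `i`: `max_j shortestDist W i j` (`⊤` if some vertex is
unreachable from `i`). Requires a nonempty vertex type (`WithTop ℤ` has no bottom element).
Source: Vassilevska Williams–Williams, J. ACM 65 (2018), §1 (Radius, Diameter of weighted graphs);
compare `SimpleGraph.eccent` for the unweighted notion. [folklore] -/
def weightedEccentricity [Nonempty ι] (W : Matrix ι ι (WithTop ℤ)) (i : ι) : WithTop ℤ :=
  Finset.univ.sup' Finset.univ_nonempty fun j => shortestDist W i j

/-- The weighted radius: `min_i max_j shortestDist W i j`.
Source: Vassilevska Williams–Williams, J. ACM 65 (2018), §1 (Radius is subcubic-equivalent to APSP,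
Abboud–Grandoni–Vassilevska Williams SODA 2015); compare `SimpleGraph.radius`. [cite: SODA2015] -/
def weightedRadius [Nonempty ι] (W : Matrix ι ι (WithTop ℤ)) : WithTop ℤ :=
  Finset.univ.inf fun i => weightedEccentricity W i

/-- The weighted diameter: `max_i max_j shortestDist W i j`.
Source: Vassilevska Williams–Williams, J. ACM 65 (2018), §1; compare `SimpleGraph.ediam`. [folklore] -/
def weightedDiameter [Nonempty ι] (W : Matrix ι ι (WithTop ℤ)) : WithTop ℤ :=
  Finset.univ.sup' Finset.univ_nonempty fun i => weightedEccentricity W i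

/-! ### API lemmas -/

/-- Walks with at most `0` edges: distance `0` on the diagonal (empty walk), `⊤` off it.
Source: CLRS §25.1 (base case `L⁽⁰⁾`). [folklore] -/
theorem walkDistLE_zero (W : Matrix ι ι (WithTop ℤ)) :
    walkDistLE W 0 = Matrix.of fun i j => if i = j then (0 : WithTop ℤ) else ⊤ := by
  ext i j
  simp only [walkDistLE, pow_zero, Matrix.map_apply, Matrix.one_apply, Matrix.of_apply]
  split_ifs <;> simp

/-- The Bellman–Ford / CLRS recurrence: a cheapest walk with at most `k + 1` edges from `i` to `j`
either has at most `k` edges or ends with an edge `l → j` after a cheapest `≤ k`-edge walk to `l`.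
Source: CLRS §25.1, recurrence (25.2). [cite: CLRS2009, §25.1 recurrence (25.2)] -/
def walkDistLE_succ_apply : Prop :=
  ∀ (W : Matrix ι ι (WithTop ℤ)) (k : ℕ) (i j : ι),
    walkDistLE W (k + 1) i j =
      min (walkDistLE W k i j) (Finset.univ.inf fun l => walkDistLE W k i l + W l j)

/-- `walkDistLE W k` is antitone in `k`: allowing more edges can only decrease the optimum.
Source: CLRS §25.1. [cite: CLRS2009, §25.1] -/
def walkDistLE_antitone : Prop :=
  ∀ (W : Matrix ι ι (WithTop ℤ)) (i j : ι),
    Antitone fun k => walkDistLE W k i j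

/-- `shortestDist W` is bounded above by every `≤ k`-edge walk optimum with `k ≤ card ι`.
Source: CLRS §25.1. [cite: CLRS2009, §25.1] -/
def shortestDist_le_of_le : Prop :=
  ∀ (W : Matrix ι ι (WithTop ℤ)) {k : ℕ} (hk : k ≤ Fintype.card ι) (i j : ι),
    shortestDist W i j ≤ walkDistLE W k i j

/-- Without negative cycles the walk optima stabilise from `card ι - 1` edges on: for every
`k ≥ card ι - 1` (stated as `card ι ≤ k + 1`), `walkDistLE W k = shortestDist W`.
Source: CLRS §25.1 (`L⁽ᵐ⁾ = L⁽ⁿ⁻¹⁾` for all `m ≥ n - 1`), relying on Lemma 24.10 / the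
path-simplification argument of §24. [cite: CLRS2009, §25.1 and Lemma 24.10] -/
def shortestDist_eq_walkDistLE_of_le : Prop :=
  ∀ (W : Matrix ι ι (WithTop ℤ)) (h : HasNoNegativeCycle W) {k : ℕ} (hk : Fintype.card ι ≤ k + 1),
    shortestDist W = walkDistLE W k

/-- Triangle inequality for shortest-path distances in the absence of negative cycles.
Source: CLRS Lemma 24.10 (triangle inequality). [cite: CLRS2009, Lemma 24.10] -/
def shortestDist_triangle : Prop :=
  ∀ (W : Matrix ι ι (WithTop ℤ)) (h : HasNoNegativeCycle W) (i j l : ι),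
    shortestDist W i l ≤ shortestDist W i j + shortestDist W j l

/-- Unit weights have no negative cycle. Source: immediate (all weights are nonnegative). [cite: CLRS2009, §24 (nonnegative weights admit no negative-weight cycle)] -/
def hasNoNegativeCycle_zeroOneWeights : Prop :=
  ∀ (G : SimpleGraph ι) [DecidableRel G.Adj],
    HasNoNegativeCycle (zeroOneWeights G)

/-- The weighted shortest distance for unit weights is the graph (extended) distance
`SimpleGraph.edist`, transported along `ℕ∞ → WithTop ℤ`.
Source: Vassilevska Williams–Williams, J. ACM 65 (2018), §1 (unweighted APSP as a special case). [cite: VassilevskaWilliamsWilliams2018, §1] -/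
def shortestDist_zeroOneWeights : Prop :=
  ∀ (G : SimpleGraph ι) [DecidableRel G.Adj] (i j : ι),
    shortestDist (zeroOneWeights G) i j = (G.edist i j).map (Nat.cast : ℕ → ℤ)

/-- The weighted eccentricity for unit weights is `SimpleGraph.eccent`, transported along
`ℕ∞ → WithTop ℤ`. Source: as for `shortestDist_zeroOneWeights`. [cite: VassilevskaWilliamsWilliams2018, §1] -/
def weightedEccentricity_zeroOneWeights : Prop :=
  ∀ [Nonempty ι] (G : SimpleGraph ι) [DecidableRel G.Adj] (i : ι),
    weightedEccentricity (zeroOneWeights G) i = (G.eccent i).map (Nat.cast : ℕ → ℤ)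

/-- Negative Triangle via one `(min,+)`-product (the easy direction of the VW–W equivalence, used to
reduce Negative Triangle to the distance product): with `W'` the matrix `W` with `⊤` on the diagonal,
`W` has a negative triangle iff some off-diagonal entry satisfies `(W' ⋆ W') i j + W j i < 0`.
Source: Vassilevska Williams–Williams, J. ACM 65 (2018), §4.1 (Negative Triangle ≤ (min,+)-product). [cite: VassilevskaWilliamsWilliams2018, §4.1] -/
def hasNegativeTriangle_iff_minPlus : Prop :=
  ∀ (W : Matrix ι ι ℤ),
    HasNegativeTriangle W ↔
      ∃ i j, i ≠ j ∧
        minPlusProduct (Matrix.of fun a b => if a = b then ⊤ else (W a b : WithTop ℤ))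
            (Matrix.of fun a b => if a = b then ⊤ else (W a b : WithTop ℤ)) i j
          + (W j i : WithTop ℤ) < 0

end Fintype

end Literature.Computability.Cryptography
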